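import Literature.Algebra.Homology.HeisenbergObstructionQuadratic
import HarnessLib

/-!
# The obstruction `2`-cocycle of a crossed homomorphism, III: transport of the module and of the values

Sequel of `HeisenbergObstructionCocycle.lean` / `HeisenbergObstructionQuadratic.lean` (same conventions;
`D : HeisenbergDatum G M A`, `conn ξ (σ,τ) = χ_σ(ξ_τ) + m(ξ_σ, σξ_τ)`).  Two bookkeeping constructions
needed to move the level-`2` theta datum from its frame `𝔽₂²` to `E[2]` and from `K̄ˣ` to `μ₂`:

* `along` — transport of the `M`-variable along an additive map `e : M′ → M` intertwining a given action
  `ρ′` on `M′` with `ρ` (`m′(x,y) = m(e x, e y)`, `χ′_σ(x) = χ_σ(e x)`); `conn_along : conn′ ξ = conn (e ∘ ξ)`,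
  `commForm_along`, `isCrossedHom_along`;
* `codRestrict` — restriction of the VALUES to an `α`-stable subgroup `A₀ ≤ A` containing all `m(x,y)`
  and `χ_σ(x)`; `coe_conn_codRestrict : (conn₀ ξ : A) = conn ξ`, `coe_commForm_codRestrict`.

References: Brown, *Cohomology of Groups* IV §3; Serre, *Galois Cohomology* I §5.7–5.8 (functoriality of
non-abelian cohomology in the group and in the coefficients) [SerreGaloisCohomology1997].  Elementary
algebra, complete proofs, no named fact.
-/

set_option autoImplicit false

namespace Literature.Algebra.Homology

namespace HeisenbergDatum

universe u v v' w

variable {G : Type u} {M : Type v} {M' : Type v'} {A : Type w} [Monoid G] [AddCommGroup M] [AddCommGroup M']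
  [AddCommGroup A]
variable (D : HeisenbergDatum G M A)

/-! ### Transport of the module along an intertwining additive map -/

/-- **Transport along `e : M′ → M`.**  Given an action `ρ′` of `G` on `M′` and an additive map `e`
with `e(ρ′_σ x) = ρ_σ(e x)`, the datum `(ρ′, α, m ∘ (e × e), χ_σ ∘ e)` on `M′` (the pull-back of the
central extension `V → M` along `e`). [cite: SerreGaloisCohomology1997, I §5.8 (functoriality of non-abelian cohomology)] -/
def along (ρ' : G →* AddMonoid.End M') (e : M' →+ M) (he : ∀ (g : G) (x : M'), e (ρ' g x) = D.ρ g (e x)) :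
    HeisenbergDatum G M' A where
  ρ := ρ'
  α := D.α
  m x y := D.m (e x) (e y)
  χ g x := D.χ g (e x)
  m_zero_left y := by rw [map_zero, D.m_zero_left]
  m_zero_right x := by rw [map_zero, D.m_zero_right]
  m_cocycle x y z := by simpa only [map_add] using D.m_cocycle (e x) (e y) (e z)
  smul_m g x y := by simpa only [map_add, he] using D.smul_m g (e x) (e y)
  χ_mul g h x := by simpa only [he] using D.χ_mul g h (e x)

section Along

variable (ρ' : G →* AddMonoid.End M') (e : M' →+ M) (he : ∀ (g : G) (x : M'), e (ρ' g x) = D.ρ g (e x))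

/-- The action of the transported datum is `ρ′`. [cite: SerreGaloisCohomology1997, I §5.8 (functoriality of non-abelian cohomology)] -/
@[simp] theorem along_ρ : (D.along ρ' e he).ρ = ρ' := rfl
/-- The value action of the transported datum is unchanged. [cite: SerreGaloisCohomology1997, I §5.8 (functoriality of non-abelian cohomology)] -/
@[simp] theorem along_α : (D.along ρ' e he).α = D.α := rfl
/-- The cocycle of the transported datum. [cite: SerreGaloisCohomology1997, I §5.8 (functoriality of non-abelian cohomology)] -/
@[simp] theorem along_m (x y : M') : (D.along ρ' e he).m x y = D.m (e x) (e y) := rfl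
/-- The correction terms of the transported datum. [cite: SerreGaloisCohomology1997, I §5.8 (functoriality of non-abelian cohomology)] -/
@[simp] theorem along_χ (g : G) (x : M') : (D.along ρ' e he).χ g x = D.χ g (e x) := rfl

/-- The commutator form of the transported datum is the pull-back of `e`.
[cite: PoonenRains2012, Prop. 4.5 (c) (commutator pairing of the Heisenberg group)] -/
@[simp] theorem commForm_along (x y : M') : (D.along ρ' e he).commForm x y = D.commForm (e x) (e y) := rfl

/-- A crossed homomorphism for the transported datum maps under `e` to a crossed homomorphism for `D`.
[cite: SerreGaloisCohomology1997, I §5.8 (functoriality of non-abelian cohomology)] -/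
theorem isCrossedHom_along {ξ : G → M'} (hξ : (D.along ρ' e he).IsCrossedHom ξ) :
    D.IsCrossedHom (e ∘ ξ) := fun g h => by
  simp only [Function.comp_apply, hξ g h, along_ρ, map_add, he]

/-- `conn` of the transported datum is `conn` of the image crossed homomorphism: `conn′ ξ = conn (e ∘ ξ)`.
[cite: SerreGaloisCohomology1997, I §5.8 (functoriality of non-abelian cohomology)] -/
theorem conn_along (ξ : G → M') (g h : G) : (D.along ρ' e he).conn ξ g h = D.conn (e ∘ ξ) g h := by
  simp only [conn, along_χ, along_m, along_ρ, Function.comp_apply, he]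

end Along

/-! ### Restriction of the values to a stable subgroup -/

section CodRestrict

variable (A₀ : AddSubgroup A) (hα : ∀ (g : G) (a : A), a ∈ A₀ → D.α g a ∈ A₀)
  (hm : ∀ x y : M, D.m x y ∈ A₀) (hχ : ∀ (g : G) (x : M), D.χ g x ∈ A₀)

/-- The action of `G` on an `α`-stable subgroup `A₀`. [cite: SerreGaloisCohomology1997, I §5.8 (functoriality in the coefficients)] -/
def restrictAction : G →* AddMonoid.End A₀ where
  toFun g := ((D.α g).comp A₀.subtype).codRestrict A₀ fun a => hα g a a.2
  map_one' := by
    apply AddMonoidHom.ext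
    intro a
    apply Subtype.ext
    show D.α 1 (a : A) = a
    rw [map_one]
    rfl
  map_mul' g h := by
    apply AddMonoidHom.ext
    intro a
    apply Subtype.ext
    show D.α (g * h) (a : A) = D.α g (D.α h (a : A))
    rw [map_mul]
    rfl

/-- Values of the restricted action. [cite: SerreGaloisCohomology1997, I §5.8 (functoriality in the coefficients)] -/
@[simp] theorem coe_restrictAction (g : G) (a : A₀) : ((D.restrictAction A₀ hα g a : A₀) : A) = D.α g a := rfl

/-- **Restriction of the values** of a Heisenberg datum to an `α`-stable subgroup `A₀` containing all the
structure constants `m(x,y)` and correction terms `χ_σ(x)` (e.g. `μ₂ ≤ K̄ˣ` for the level-`2` theta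
datum). [cite: SerreGaloisCohomology1997, I §5.8 (functoriality in the coefficients)] -/
def codRestrict : HeisenbergDatum G M A₀ where
  ρ := D.ρ
  α := D.restrictAction A₀ hα
  m x y := ⟨D.m x y, hm x y⟩
  χ g x := ⟨D.χ g x, hχ g x⟩
  m_zero_left y := Subtype.ext (D.m_zero_left y)
  m_zero_right x := Subtype.ext (D.m_zero_right x)
  m_cocycle x y z := Subtype.ext (D.m_cocycle x y z)
  smul_m g x y := Subtype.ext (D.smul_m g x y)
  χ_mul g h x := Subtype.ext (D.χ_mul g h x)

/-- The action of the value-restricted datum is unchanged on `M`. [cite: SerreGaloisCohomology1997, I §5.8 (functoriality in the coefficients)] -/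
@[simp] theorem codRestrict_ρ : (D.codRestrict A₀ hα hm hχ).ρ = D.ρ := rfl
/-- The cocycle of the value-restricted datum. [cite: SerreGaloisCohomology1997, I §5.8 (functoriality in the coefficients)] -/
@[simp] theorem coe_codRestrict_m (x y : M) : ((D.codRestrict A₀ hα hm hχ).m x y : A) = D.m x y := rfl
/-- The correction terms of the value-restricted datum. [cite: SerreGaloisCohomology1997, I §5.8 (functoriality in the coefficients)] -/
@[simp] theorem coe_codRestrict_χ (g : G) (x : M) : ((D.codRestrict A₀ hα hm hχ).χ g x : A) = D.χ g x := rfl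

/-- Crossed homomorphisms are the same for `D` and its value restriction. [cite: SerreGaloisCohomology1997, I §5.1 (cocycles, crossed homomorphisms)] -/
theorem isCrossedHom_codRestrict_iff (ξ : G → M) :
    (D.codRestrict A₀ hα hm hχ).IsCrossedHom ξ ↔ D.IsCrossedHom ξ := Iff.rfl

/-- `conn` of the value-restricted datum is `conn`, valued in `A₀`: `(conn₀ ξ : A) = conn ξ`.
[cite: SerreGaloisCohomology1997, I §5.7 (connecting map of a central extension of G-groups)] -/
@[simp] theorem coe_conn_codRestrict (ξ : G → M) (g h : G) :
    ((D.codRestrict A₀ hα hm hχ).conn ξ g h : A) = D.conn ξ g h := rfl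

/-- The commutator form of the value-restricted datum, in `A`. [cite: PoonenRains2012, Prop. 4.5 (c) (commutator pairing of the Heisenberg group)] -/
@[simp] theorem coe_commForm_codRestrict (x y : M) :
    ((D.codRestrict A₀ hα hm hχ).commForm x y : A) = D.commForm x y := rfl

end CodRestrict

/-! ### Push-forward of the values along an equivariant additive map -/

section MapValues

variable {A' : Type*} [AddCommGroup A'] (ψ : A →+ A') (α' : G →* AddMonoid.End A')
  (hψ : ∀ (g : G) (a : A), ψ (D.α g a) = α' g (ψ a))

/-- **Push-forward of the values** along an additive map `ψ : A → A′` intertwining the actions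
(`ψ(σa) = σ ψ(a)`): the datum `(ρ, α′, ψ ∘ m, ψ ∘ χ)` (the push-out of the central extension along `ψ`).
[cite: SerreGaloisCohomology1997, I §5.8 (functoriality in the coefficients)] -/
def mapValues : HeisenbergDatum G M A' where
  ρ := D.ρ
  α := α'
  m x y := ψ (D.m x y)
  χ g x := ψ (D.χ g x)
  m_zero_left y := by rw [D.m_zero_left, map_zero]
  m_zero_right x := by rw [D.m_zero_right, map_zero]
  m_cocycle x y z := by simpa only [map_add] using congrArg ψ (D.m_cocycle x y z)
  smul_m g x y := by simpa only [map_add, hψ] using congrArg ψ (D.smul_m g x y)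
  χ_mul g h x := by simpa only [map_add, hψ] using congrArg ψ (D.χ_mul g h x)

/-- The module action of the pushed-forward datum is unchanged. [cite: SerreGaloisCohomology1997, I §5.8 (functoriality in the coefficients)] -/
@[simp] theorem mapValues_ρ : (D.mapValues ψ α' hψ).ρ = D.ρ := rfl
/-- The value action of the pushed-forward datum is `α′`. [cite: SerreGaloisCohomology1997, I §5.8 (functoriality in the coefficients)] -/
@[simp] theorem mapValues_α : (D.mapValues ψ α' hψ).α = α' := rfl
/-- The cocycle of the pushed-forward datum. [cite: SerreGaloisCohomology1997, I §5.8 (functoriality in the coefficients)] -/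
@[simp] theorem mapValues_m (x y : M) : (D.mapValues ψ α' hψ).m x y = ψ (D.m x y) := rfl
/-- The correction terms of the pushed-forward datum. [cite: SerreGaloisCohomology1997, I §5.8 (functoriality in the coefficients)] -/
@[simp] theorem mapValues_χ (g : G) (x : M) : (D.mapValues ψ α' hψ).χ g x = ψ (D.χ g x) := rfl

/-- Crossed homomorphisms are the same for `D` and its push-forward. [cite: SerreGaloisCohomology1997, I §5.1 (cocycles, crossed homomorphisms)] -/
theorem isCrossedHom_mapValues_iff (ξ : G → M) :
    (D.mapValues ψ α' hψ).IsCrossedHom ξ ↔ D.IsCrossedHom ξ := Iff.rfl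

/-- `conn` of the pushed-forward datum is `ψ ∘ conn`. [cite: SerreGaloisCohomology1997, I §5.7 (connecting map of a central extension of G-groups)] -/
@[simp] theorem conn_mapValues (ξ : G → M) (g h : G) :
    (D.mapValues ψ α' hψ).conn ξ g h = ψ (D.conn ξ g h) := by
  simp only [conn, mapValues_χ, mapValues_m, mapValues_ρ, map_add]

/-- The commutator form of the pushed-forward datum is `ψ ∘ e`. [cite: PoonenRains2012, Prop. 4.5 (c) (commutator pairing of the Heisenberg group)] -/
@[simp] theorem commForm_mapValues (x y : M) :
    (D.mapValues ψ α' hψ).commForm x y = ψ (D.commForm x y) := by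
  simp only [commForm, mapValues_m, map_sub]

end MapValues

end HeisenbergDatum

end Literature.Algebra.Homology
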